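import Literature.Topology.CoveringSpaces.CoveringIdRigid
import Literature.GroupTheory.ActionIdentityEndomorphisms
import Literature.GroupTheory.CombinatorialGroupTheory.FreeGroupCentralizers
import HarnessLib

/-!
# Id-rigidity of the category of ALL covering spaces: `Cov(X)` is id-rigid iff `Z(π₁(X)) = 1`;
# the thrice-punctured sphere (every `ℂ ∖ F`, `2 ≤ |F| < ∞`) unconditionally

Topic `Literature/Topology/CoveringSpaces` — sequel of `CoveringIdRigid.lean` (abc-iut cell,
campaign-L R1, GAP row G-L4t14-R1): the DISCRETE companion of «`π̂₁` slim ⇒ `Cov^fin(X)` id-rigid».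
By `Cov.galoisCorrespondence : Cov X ≌ π₁(X, x₀)-Set` and `ActionIdentityEndomorphisms`
(`End(𝟭_{G-Set}) = Z(G)`):

* **`Cov.isIdRigid_iff_center_eq_bot`** — for `X` path connected and strongly locally contractible,
  every automorphism of the identity functor of `Cov(X)` is trivial iff `π₁(X, x₀)` is centre-free;
* `center_eq_bot_of_mulEquiv_freeGroup` — free groups of rank `≥ 2` are centre-free (the tree's
  `IsFreeGroup.isCyclic_of_mem_center`);
* `Cov.isIdRigid_of_mulEquiv_freeGroup`, `CovFin.isIdRigid_of_mulEquiv_freeGroup` — consumer forms: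
  `π₁(X, x₀) ≅ F_n`, `n ≥ 2` ⇒ `Cov(X)` and `Cov^fin(X)` id-rigid;
* **`Cov.isIdRigid_compl_finite`**, `Cov.isIdRigid_thricePuncturedSphere` — `Cov(ℂ ∖ F)` is id-rigid
  for `F` finite, `2 ≤ |F|`.

(The finite-cover criterion with the centre of `π̂₁` and the slices `Over E` are f-072's
`CovFin.isIdRigid_iff_center_eq_bot` / `CovFin.isIdRigid_over`, `CoveringSlicesIdRigid.lean`.)

Everything is proved; no definitions, no instances, no named facts.

## References

* S. Mochizuki, *Topics in Absolute Anabelian Geometry III*, §0 p. 27, Proposition 4.2 (i) p. 106.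
  [MochizukiAbsTopIII2015]
* S. Mochizuki, *The absolute anabelian geometry of hyperbolic curves*, Lemma 1.3.1.
  [MochizukiAbsAnab2004]
* A. Hatcher, *Algebraic Topology*, CUP 2002, §1.3 Thm. 1.38. [HatcherAT2002]
-/

noncomputable section

open CategoryTheory Set
open Literature.AnabelianGeometry.AbsoluteAnabelian (IsIdRigid isIdRigid_of_equivalence)

universe u

namespace Literature.Topology.CoveringSpaces

/-! ### §3 ALL covering spaces: `Cov(X)` is id-rigid iff `π₁(X, x₀)` is centre-free -/

namespace Cov

variable {X : Type u} [TopologicalSpace X] [PathConnectedSpace X] [StronglyLocallyContractibleSpace X]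
  (x₀ : X)

/-- **`Z(π₁(X, x₀)) = 1` ⇒ the category `Cov(X)` of ALL covering spaces of `X` is id-rigid** (the
discrete companion of `CovFin.isIdRigid_of_isSlimGroup`: natural endomorphisms of `𝟭_{π₁-Set}` are
central elements, `ActionCenter.isIdRigid_action_of_center_eq_bot`, transported along
`Cov.galoisCorrespondence`). [cite: MochizukiAbsTopIII2015, Section 0 p.27] -/
theorem isIdRigid_of_center_eq_bot (h : Subgroup.center (FundamentalGroup X x₀) = ⊥) :
    IsIdRigid (Cov X) :=
  isIdRigid_of_equivalence (Cov.galoisCorrespondence x₀)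
    (Literature.GroupTheory.ActionCenter.isIdRigid_action_of_center_eq_bot h)

/-- Conversely an id-rigid `Cov(X)` forces `Z(π₁(X, x₀)) = 1` (a central loop class acts as a
natural family of deck transformations). [cite: MochizukiAbsTopIII2015, Section 0 p.27] -/
theorem center_eq_bot_of_isIdRigid (h : IsIdRigid (Cov X)) :
    Subgroup.center (FundamentalGroup X x₀) = ⊥ :=
  Literature.GroupTheory.ActionCenter.center_eq_bot_of_isIdRigid_action
    (Literature.AnabelianGeometry.AbsoluteAnabelian.isIdRigid_of_equivalence'
      (Cov.galoisCorrespondence x₀) h)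

/-- **`Cov(X)` is id-rigid iff `π₁(X, x₀)` is centre-free.**
[cite: MochizukiAbsTopIII2015, Section 0 p.27] -/
theorem isIdRigid_iff_center_eq_bot :
    IsIdRigid (Cov X) ↔ Subgroup.center (FundamentalGroup X x₀) = ⊥ :=
  ⟨center_eq_bot_of_isIdRigid x₀, isIdRigid_of_center_eq_bot x₀⟩

end Cov

/-- A group isomorphic to a free group of rank `≥ 2` is centre-free (a free group with a
non-trivial central element is cyclic — the tree's `IsFreeGroup.isCyclic_of_mem_center` — hence
commutative, while `F_n`, `n ≥ 2`, is not). [cite: MochizukiAbsAnab2004, Lemma 1.3.1 p.15] -/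
theorem center_eq_bot_of_mulEquiv_freeGroup {G : Type u} [Group G] {n : ℕ}
    (e : G ≃* FreeGroup (Fin n)) (hn : 2 ≤ n) : Subgroup.center G = ⊥ := by
  haveI : IsFreeGroup G := IsFreeGroup.ofMulEquiv e.symm
  rw [eq_bot_iff]
  intro z hz
  rw [Subgroup.mem_bot]
  by_contra hz1
  haveI := Literature.GroupTheory.CombinatorialGroupTheory.IsFreeGroup.isCyclic_of_mem_center hz hz1
  obtain ⟨x, y, hxy⟩ := Literature.GroupTheory.exists_mul_ne_mul_of_mulEquiv e
    (Literature.GroupTheory.FreeGroup.exists_mul_ne_mul_fin hn)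
  letI := IsCyclic.commGroup (α := G)
  exact hxy (mul_comm x y)

/-- **`π₁(X, x₀) ≅ F_n` with `n ≥ 2` ⇒ `Cov(X)` (ALL covers) is id-rigid** — the consumer form for
concrete spaces (punctured planes, punctured tori, …). [cite: MochizukiAbsTopIII2015, Proposition 4.2 (i) p.106] -/
theorem Cov.isIdRigid_of_mulEquiv_freeGroup {X : Type u} [TopologicalSpace X] [PathConnectedSpace X]
    [StronglyLocallyContractibleSpace X] (x₀ : X) {n : ℕ}
    (e : FundamentalGroup X x₀ ≃* FreeGroup (Fin n)) (hn : 2 ≤ n) : IsIdRigid (Cov X) :=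
  Cov.isIdRigid_of_center_eq_bot x₀ (center_eq_bot_of_mulEquiv_freeGroup e hn)

/-- **`π₁(X, x₀) ≅ F_n` with `n ≥ 2` ⇒ `Cov^fin(X)` is id-rigid** (`π̂₁` is then slim — the tree's
`isSlimGroup_profiniteCompletion_of_mulEquiv_freeGroup`; universe `0`).
[cite: MochizukiAbsTopIII2015, Proposition 4.2 (i) p.106] -/
theorem CovFin.isIdRigid_of_mulEquiv_freeGroup {X : Type} [TopologicalSpace X] [PathConnectedSpace X]
    [StronglyLocallyContractibleSpace X] (x₀ : X) {n : ℕ}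
    (e : FundamentalGroup X x₀ ≃* FreeGroup (Fin n)) (hn : 2 ≤ n) : IsIdRigid (CovFin X) :=
  CovFin.isIdRigid_of_isSlimGroup x₀
    (Literature.GroupTheory.isSlimGroup_profiniteCompletion_of_mulEquiv_freeGroup e hn)

/-- **The category of ALL covering spaces of `ℂ ∖ F` is id-rigid** for `F` finite with `2 ≤ |F|`.
[cite: MochizukiAbsTopIII2015, Proposition 4.2 (i) p.106] -/
theorem Cov.isIdRigid_compl_finite {F : Set ℂ} (hF : F.Finite) (h2 : 2 ≤ F.ncard) :
    IsIdRigid (Cov ↥(Fᶜ)) := by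
  haveI := pathConnectedSpace_compl_finite hF
  haveI := stronglyLocallyContractibleSpace_compl_finite hF
  have x : ↥(Fᶜ) := Classical.arbitrary _
  obtain ⟨e⟩ :=
    Literature.AlgebraicTopology.FundamentalGroup.nonempty_mulEquiv_freeGroup_compl_finite hF x
  exact Cov.isIdRigid_of_mulEquiv_freeGroup x e h2

/-- The thrice-punctured sphere: `Cov(ℂ ∖ {0, 1})` (all covers) is id-rigid.
[cite: MochizukiAbsTopIII2015, Proposition 4.2 (i) p.106] -/
theorem Cov.isIdRigid_thricePuncturedSphere : IsIdRigid (Cov ↥(({0, 1} : Set ℂ)ᶜ)) :=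
  Cov.isIdRigid_compl_finite (Set.toFinite _) (by rw [Set.ncard_pair (by norm_num)])

end Literature.Topology.CoveringSpaces

end
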